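import Summits.QuantumFields.YangMills.Theorems.ColdStartUniversalityLatticeLangevinLiebRobinsonCorrelationLightConePointwise
import Summits.QuantumFields.YangMills.Theorems.ColdStartUniversalityLatticeLangevinCylinderDynkinBound
import HarnessLib

/-!
# Route `ColdStartUniversality` (fixed-cut-off SZZ dynamics; LIEB–ROBINSON / LOCALITY package, file 43):
# ★★★ THE SPACE-TIME LIGHT CONE FROM A DETERMINISTIC START — two-time correlations `κ_s(F·κ_tG)(x) − κ_sF(x)·κ_(s+t)G(x)`, every coupling

Helper file (seat `ym-line-csu-p1`, g32; `--supports stmt-QuantumFields-24809`).  The two-time correlation function of the SZZ process started at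
a point `x`, DEFINED THROUGH THE SEMIGROUP (Markov property): `E_x[F(U_s)G(U_(s+t))] − E_x[F(U_s)]E_x[G(U_(s+t))] = κ_s(F·κ_tG)(x) − κ_sF(x)·κ_(s+t)G(x)`
(Chapman–Kolmogorov `κ_s(κ_tG) = κ_(s+t)G`, `transition_transition_cylinder_eq`).  It is the equal-time covariance at time `s` of `F` and of the
EVOLVED observable `κ_tG`, whose link-Lipschitz profile is the Lieb–Robinson profile of `G` (g30, `transitionKernel_linkLipschitz_profile`); the
pointwise light cone of file 35 (`transition_covariance_abs_le_lightCone`) and one more convolution of exponential kernels on the torus give: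
* ★ `overlapSum_convolution_le_of_separated` — for profiles on link sets at cyclic sup-distance `≥ R+1`,
  `Σ_e (Σ_a ℓ^F_a 108^(−D(a,e)))·(Σ_e' (Σ_b ℓ^G_b 108^(−D(b,e'))) 108^(−D(e',e))) ≤ 36·2^(−(R+1))·Σℓ^F·Σℓ^G` (triangle inequality twice, two volume-free sums);
* ★★★ `transition_twoTime_covariance_abs_le_lightCone_of_separated` — for `C³` `f, g` with profiles on link sets at distance `≥ R+1`, every realising
  kernel family, all lattice times `s, t`, EVERY start `x`:  `|κ_s(F·κ_tG)(x) − κ_sF(x)·κ_(t+s)G(x)| ≤ 576·s·e^(λ(2s+t))·2^(−(R+1))·Σℓ^F·Σℓ^G`,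
  `λ = (1300+4√2)|β'|` — from a point, `F` at time `s` and `G` at time `s+t` are uncorrelated until the cones (two of slope `λ` from time `0` to `s`, one
  of slope `λ` over the extra time `t`) meet; every coupling, no volume factor.
THEOREMS ONLY, no definition, no sorry; [folklore].  HONEST FRAMING: fixed cut-off; kernel (semigroup) form only — the two-time Markov property of
arbitrary strong solutions is not in the tree; cone slope `λ ∝ |β'|` ⇒ nothing `K`-uniform in physical units; `UniformColdStartMixing` (24809) is NOT
restated; no crux, rung or summit statement is proved; the Yang–Mills mass gap is NOT proved.
-/

set_option autoImplicit false

noncomputable section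

namespace Summit.QuantumFields.YangMills.Theorems.ColdStartUniversality.LiebRobinson

open MeasureTheory ProbabilityTheory Matrix Complex Finset Filter Set Metric
open scoped ComplexConjugate BigOperators Matrix NNReal ENNReal Topology
open Literature.Probability.Process Literature.MathematicalPhysics.QuantumFieldTheory
open Literature.MathematicalPhysics.QuantumFieldTheory.Balaban1983to89
open Literature.MathematicalPhysics.QuantumLattice (fundamentalRep fundamentalLatticeRep continuous_fundamentalRep fundamentalRep_apply)

variable {L : ℕ} [NeZero L]

/-! ## §1. Two separated profiles, one of them convolved once more with the torus kernel -/

/-- ★ **Overlap of a light cone with a twice-propagated one.**  For `ℓ^F ≥ 0` vanishing off `Λ_F`, `ℓ^G ≥ 0` vanishing off `Λ_G`, base sites of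
`Λ_F, Λ_G` at cyclic sup-distance `≥ R+1`:
`Σ_e (Σ_a ℓ^F_a 108^(−D(a,e)))·(Σ_e' (Σ_b ℓ^G_b 108^(−D(b,e')))·108^(−D(e',e))) ≤ 36·2^(−(R+1))·Σℓ^F·Σℓ^G`. [folklore] -/
theorem overlapSum_convolution_le_of_separated {ℓF ℓG : Edge 3 L → ℝ} (hℓF : ∀ e, 0 ≤ ℓF e) (hℓG : ∀ e, 0 ≤ ℓG e)
    (Λf Λg : Finset (Edge 3 L)) (hΛf : ∀ e, e ∉ Λf → ℓF e = 0) (hΛg : ∀ e, e ∉ Λg → ℓG e = 0) (R : ℕ)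
    (hsep : ∀ e' ∈ Λf, ∀ e ∈ Λg, R + 1 ≤ (Finset.univ.sup fun i : Fin 3 => ((e'.1 i - e.1 i).valMinAbs).natAbs)) :
    (∑ e : Edge 3 L, (∑ a : Edge 3 L, ℓF a * ((108 : ℝ)⁻¹) ^ (Finset.univ.sup fun i : Fin 3 => ((a.1 i - e.1 i).valMinAbs).natAbs)) *
      (∑ e' : Edge 3 L, (∑ b : Edge 3 L, ℓG b * ((108 : ℝ)⁻¹) ^ (Finset.univ.sup fun i : Fin 3 => ((b.1 i - e'.1 i).valMinAbs).natAbs)) * ((108 : ℝ)⁻¹) ^ (Finset.univ.sup fun i : Fin 3 => ((e'.1 i - e.1 i).valMinAbs).natAbs))) ≤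
      36 * ((2 : ℝ)⁻¹) ^ (R + 1) * ((∑ e : Edge 3 L, ℓF e) * ∑ e : Edge 3 L, ℓG e) := by
  classical
  -- termwise: `ℓF a ℓG b 108^(−D(a,e)) 108^(−D(b,e')) 108^(−D(e',e)) ≤ 2^(−(R+1)) ℓF a ℓG b 54^(−D(a,e)) 54^(−D(e',e))`
  have hterm : ∀ (e e' a b : Edge 3 L),
      ℓF a * ((108 : ℝ)⁻¹) ^ (Finset.univ.sup fun i : Fin 3 => ((a.1 i - e.1 i).valMinAbs).natAbs) * (ℓG b * ((108 : ℝ)⁻¹) ^ (Finset.univ.sup fun i : Fin 3 => ((b.1 i - e'.1 i).valMinAbs).natAbs) * ((108 : ℝ)⁻¹) ^ (Finset.univ.sup fun i : Fin 3 => ((e'.1 i - e.1 i).valMinAbs).natAbs)) ≤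
        ((2 : ℝ)⁻¹) ^ (R + 1) * (ℓF a * ((54 : ℝ)⁻¹) ^ (Finset.univ.sup fun i : Fin 3 => ((a.1 i - e.1 i).valMinAbs).natAbs)) * (ℓG b * ((54 : ℝ)⁻¹) ^ (Finset.univ.sup fun i : Fin 3 => ((e'.1 i - e.1 i).valMinAbs).natAbs)) := by
    intro e e' a b
    by_cases ha : a ∈ Λf
    · by_cases hb : b ∈ Λg
      · have h1 : (Finset.univ.sup fun i : Fin 3 => ((a.1 i - b.1 i).valMinAbs).natAbs) ≤ (Finset.univ.sup fun i : Fin 3 => ((a.1 i - e.1 i).valMinAbs).natAbs) + (Finset.univ.sup fun i : Fin 3 => ((b.1 i - e.1 i).valMinAbs).natAbs) := torusDist_le_add a b e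
        have h2 : (Finset.univ.sup fun i : Fin 3 => ((b.1 i - e.1 i).valMinAbs).natAbs) ≤ (Finset.univ.sup fun i : Fin 3 => ((b.1 i - e'.1 i).valMinAbs).natAbs) + (Finset.univ.sup fun i : Fin 3 => ((e.1 i - e'.1 i).valMinAbs).natAbs) := torusDist_le_add b e e'
        have h3 : (Finset.univ.sup fun i : Fin 3 => ((e.1 i - e'.1 i).valMinAbs).natAbs) = (Finset.univ.sup fun i : Fin 3 => ((e'.1 i - e.1 i).valMinAbs).natAbs) := torusDist_comm e'.1 e.1
        have hRle : R + 1 ≤ (Finset.univ.sup fun i : Fin 3 => ((a.1 i - e.1 i).valMinAbs).natAbs) + (Finset.univ.sup fun i : Fin 3 => ((b.1 i - e'.1 i).valMinAbs).natAbs) + (Finset.univ.sup fun i : Fin 3 => ((e'.1 i - e.1 i).valMinAbs).natAbs) := by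
          have := hsep a ha b hb; omega
        have e108a : ((108 : ℝ)⁻¹) ^ (Finset.univ.sup fun i : Fin 3 => ((a.1 i - e.1 i).valMinAbs).natAbs) = ((2 : ℝ)⁻¹) ^ (Finset.univ.sup fun i : Fin 3 => ((a.1 i - e.1 i).valMinAbs).natAbs) * ((54 : ℝ)⁻¹) ^ (Finset.univ.sup fun i : Fin 3 => ((a.1 i - e.1 i).valMinAbs).natAbs) := by rw [← mul_pow]; norm_num
        have e108b : ((108 : ℝ)⁻¹) ^ (Finset.univ.sup fun i : Fin 3 => ((b.1 i - e'.1 i).valMinAbs).natAbs) ≤ ((2 : ℝ)⁻¹) ^ (Finset.univ.sup fun i : Fin 3 => ((b.1 i - e'.1 i).valMinAbs).natAbs) :=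
          pow_le_pow_left₀ (by norm_num) (by norm_num) _
        have e108c : ((108 : ℝ)⁻¹) ^ (Finset.univ.sup fun i : Fin 3 => ((e'.1 i - e.1 i).valMinAbs).natAbs) = ((2 : ℝ)⁻¹) ^ (Finset.univ.sup fun i : Fin 3 => ((e'.1 i - e.1 i).valMinAbs).natAbs) * ((54 : ℝ)⁻¹) ^ (Finset.univ.sup fun i : Fin 3 => ((e'.1 i - e.1 i).valMinAbs).natAbs) := by rw [← mul_pow]; norm_num
        have h2pow : ((2 : ℝ)⁻¹) ^ (Finset.univ.sup fun i : Fin 3 => ((a.1 i - e.1 i).valMinAbs).natAbs) * ((2 : ℝ)⁻¹) ^ (Finset.univ.sup fun i : Fin 3 => ((b.1 i - e'.1 i).valMinAbs).natAbs) * ((2 : ℝ)⁻¹) ^ (Finset.univ.sup fun i : Fin 3 => ((e'.1 i - e.1 i).valMinAbs).natAbs) ≤ ((2 : ℝ)⁻¹) ^ (R + 1) := by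
          rw [← pow_add, ← pow_add]; exact pow_le_pow_of_le_one (by norm_num) (by norm_num) hRle
        have hprod : ((108 : ℝ)⁻¹) ^ (Finset.univ.sup fun i : Fin 3 => ((a.1 i - e.1 i).valMinAbs).natAbs) * ((108 : ℝ)⁻¹) ^ (Finset.univ.sup fun i : Fin 3 => ((b.1 i - e'.1 i).valMinAbs).natAbs) * ((108 : ℝ)⁻¹) ^ (Finset.univ.sup fun i : Fin 3 => ((e'.1 i - e.1 i).valMinAbs).natAbs) ≤
            ((2 : ℝ)⁻¹) ^ (R + 1) * ((54 : ℝ)⁻¹) ^ (Finset.univ.sup fun i : Fin 3 => ((a.1 i - e.1 i).valMinAbs).natAbs) * ((54 : ℝ)⁻¹) ^ (Finset.univ.sup fun i : Fin 3 => ((e'.1 i - e.1 i).valMinAbs).natAbs) := by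
          rw [e108a, e108c]
          have hx : 0 ≤ ((54 : ℝ)⁻¹) ^ (Finset.univ.sup fun i : Fin 3 => ((a.1 i - e.1 i).valMinAbs).natAbs) * ((54 : ℝ)⁻¹) ^ (Finset.univ.sup fun i : Fin 3 => ((e'.1 i - e.1 i).valMinAbs).natAbs) := by positivity
          calc ((2 : ℝ)⁻¹) ^ (Finset.univ.sup fun i : Fin 3 => ((a.1 i - e.1 i).valMinAbs).natAbs) * ((54 : ℝ)⁻¹) ^ (Finset.univ.sup fun i : Fin 3 => ((a.1 i - e.1 i).valMinAbs).natAbs) * ((108 : ℝ)⁻¹) ^ (Finset.univ.sup fun i : Fin 3 => ((b.1 i - e'.1 i).valMinAbs).natAbs) * (((2 : ℝ)⁻¹) ^ (Finset.univ.sup fun i : Fin 3 => ((e'.1 i - e.1 i).valMinAbs).natAbs) * ((54 : ℝ)⁻¹) ^ (Finset.univ.sup fun i : Fin 3 => ((e'.1 i - e.1 i).valMinAbs).natAbs))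
              = (((2 : ℝ)⁻¹) ^ (Finset.univ.sup fun i : Fin 3 => ((a.1 i - e.1 i).valMinAbs).natAbs) * ((108 : ℝ)⁻¹) ^ (Finset.univ.sup fun i : Fin 3 => ((b.1 i - e'.1 i).valMinAbs).natAbs) * ((2 : ℝ)⁻¹) ^ (Finset.univ.sup fun i : Fin 3 => ((e'.1 i - e.1 i).valMinAbs).natAbs)) * (((54 : ℝ)⁻¹) ^ (Finset.univ.sup fun i : Fin 3 => ((a.1 i - e.1 i).valMinAbs).natAbs) * ((54 : ℝ)⁻¹) ^ (Finset.univ.sup fun i : Fin 3 => ((e'.1 i - e.1 i).valMinAbs).natAbs)) := by ring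
            _ ≤ (((2 : ℝ)⁻¹) ^ (Finset.univ.sup fun i : Fin 3 => ((a.1 i - e.1 i).valMinAbs).natAbs) * ((2 : ℝ)⁻¹) ^ (Finset.univ.sup fun i : Fin 3 => ((b.1 i - e'.1 i).valMinAbs).natAbs) * ((2 : ℝ)⁻¹) ^ (Finset.univ.sup fun i : Fin 3 => ((e'.1 i - e.1 i).valMinAbs).natAbs)) * (((54 : ℝ)⁻¹) ^ (Finset.univ.sup fun i : Fin 3 => ((a.1 i - e.1 i).valMinAbs).natAbs) * ((54 : ℝ)⁻¹) ^ (Finset.univ.sup fun i : Fin 3 => ((e'.1 i - e.1 i).valMinAbs).natAbs)) :=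
                mul_le_mul_of_nonneg_right (mul_le_mul_of_nonneg_right (mul_le_mul_of_nonneg_left e108b (by positivity)) (by positivity)) hx
            _ ≤ ((2 : ℝ)⁻¹) ^ (R + 1) * (((54 : ℝ)⁻¹) ^ (Finset.univ.sup fun i : Fin 3 => ((a.1 i - e.1 i).valMinAbs).natAbs) * ((54 : ℝ)⁻¹) ^ (Finset.univ.sup fun i : Fin 3 => ((e'.1 i - e.1 i).valMinAbs).natAbs)) := mul_le_mul_of_nonneg_right h2pow hx
            _ = _ := by ring
        have hab : 0 ≤ ℓF a * ℓG b := mul_nonneg (hℓF a) (hℓG b)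
        calc ℓF a * ((108 : ℝ)⁻¹) ^ (Finset.univ.sup fun i : Fin 3 => ((a.1 i - e.1 i).valMinAbs).natAbs) * (ℓG b * ((108 : ℝ)⁻¹) ^ (Finset.univ.sup fun i : Fin 3 => ((b.1 i - e'.1 i).valMinAbs).natAbs) * ((108 : ℝ)⁻¹) ^ (Finset.univ.sup fun i : Fin 3 => ((e'.1 i - e.1 i).valMinAbs).natAbs))
            = (ℓF a * ℓG b) * (((108 : ℝ)⁻¹) ^ (Finset.univ.sup fun i : Fin 3 => ((a.1 i - e.1 i).valMinAbs).natAbs) * ((108 : ℝ)⁻¹) ^ (Finset.univ.sup fun i : Fin 3 => ((b.1 i - e'.1 i).valMinAbs).natAbs) * ((108 : ℝ)⁻¹) ^ (Finset.univ.sup fun i : Fin 3 => ((e'.1 i - e.1 i).valMinAbs).natAbs)) := by ring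
          _ ≤ (ℓF a * ℓG b) * (((2 : ℝ)⁻¹) ^ (R + 1) * ((54 : ℝ)⁻¹) ^ (Finset.univ.sup fun i : Fin 3 => ((a.1 i - e.1 i).valMinAbs).natAbs) * ((54 : ℝ)⁻¹) ^ (Finset.univ.sup fun i : Fin 3 => ((e'.1 i - e.1 i).valMinAbs).natAbs)) := mul_le_mul_of_nonneg_left hprod hab
          _ = _ := by ring
      · rw [hΛg b hb]; simp
    · rw [hΛf a ha]; simp
  -- the two volume-free sums
  have h54a : ∀ a : Edge 3 L, ∑ e : Edge 3 L, ((54 : ℝ)⁻¹) ^ (Finset.univ.sup fun i : Fin 3 => ((a.1 i - e.1 i).valMinAbs).natAbs) ≤ 6 := by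
    intro a
    calc ∑ e : Edge 3 L, ((54 : ℝ)⁻¹) ^ (Finset.univ.sup fun i : Fin 3 => ((a.1 i - e.1 i).valMinAbs).natAbs) = ∑ e : Edge 3 L, ((54 : ℝ)⁻¹) ^ (Finset.univ.sup fun i : Fin 3 => ((e.1 i - a.1 i).valMinAbs).natAbs) :=
          Finset.sum_congr rfl fun e _ => by rw [torusDist_comm e.1 a.1]
      _ ≤ 6 := sum_edge_pow_torusDist_le (L := L) a.1
  have h54e : ∀ e : Edge 3 L, ∑ e' : Edge 3 L, ((54 : ℝ)⁻¹) ^ (Finset.univ.sup fun i : Fin 3 => ((e'.1 i - e.1 i).valMinAbs).natAbs) ≤ 6 := fun e => sum_edge_pow_torusDist_le (L := L) e.1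
  obtain ⟨c, hc⟩ : ∃ c : ℝ, c = ((2 : ℝ)⁻¹) ^ (R + 1) := ⟨_, rfl⟩
  obtain ⟨SG, hSG⟩ : ∃ S : ℝ, S = ∑ b : Edge 3 L, ℓG b := ⟨_, rfl⟩
  have hSG0 : 0 ≤ SG := by rw [hSG]; exact Finset.sum_nonneg fun b _ => hℓG b
  have hc0 : 0 ≤ c := by rw [hc]; positivity
  rw [← hc] at hterm
  -- each `e`-term
  have hMe : ∀ e : Edge 3 L, (∑ a : Edge 3 L, ℓF a * ((108 : ℝ)⁻¹) ^ (Finset.univ.sup fun i : Fin 3 => ((a.1 i - e.1 i).valMinAbs).natAbs)) *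
      (∑ e' : Edge 3 L, (∑ b : Edge 3 L, ℓG b * ((108 : ℝ)⁻¹) ^ (Finset.univ.sup fun i : Fin 3 => ((b.1 i - e'.1 i).valMinAbs).natAbs)) * ((108 : ℝ)⁻¹) ^ (Finset.univ.sup fun i : Fin 3 => ((e'.1 i - e.1 i).valMinAbs).natAbs)) ≤
      6 * c * SG * ∑ a : Edge 3 L, ℓF a * ((54 : ℝ)⁻¹) ^ (Finset.univ.sup fun i : Fin 3 => ((a.1 i - e.1 i).valMinAbs).natAbs) := by
    intro e
    -- inner sum over `b`, for fixed `a, e'`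
    have hb : ∀ a e' : Edge 3 L, ∑ b : Edge 3 L, ℓF a * ((108 : ℝ)⁻¹) ^ (Finset.univ.sup fun i : Fin 3 => ((a.1 i - e.1 i).valMinAbs).natAbs) * (ℓG b * ((108 : ℝ)⁻¹) ^ (Finset.univ.sup fun i : Fin 3 => ((b.1 i - e'.1 i).valMinAbs).natAbs) * ((108 : ℝ)⁻¹) ^ (Finset.univ.sup fun i : Fin 3 => ((e'.1 i - e.1 i).valMinAbs).natAbs)) ≤
        c * SG * (ℓF a * ((54 : ℝ)⁻¹) ^ (Finset.univ.sup fun i : Fin 3 => ((a.1 i - e.1 i).valMinAbs).natAbs)) * ((54 : ℝ)⁻¹) ^ (Finset.univ.sup fun i : Fin 3 => ((e'.1 i - e.1 i).valMinAbs).natAbs) := by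
      intro a e'
      calc ∑ b : Edge 3 L, ℓF a * ((108 : ℝ)⁻¹) ^ (Finset.univ.sup fun i : Fin 3 => ((a.1 i - e.1 i).valMinAbs).natAbs) * (ℓG b * ((108 : ℝ)⁻¹) ^ (Finset.univ.sup fun i : Fin 3 => ((b.1 i - e'.1 i).valMinAbs).natAbs) * ((108 : ℝ)⁻¹) ^ (Finset.univ.sup fun i : Fin 3 => ((e'.1 i - e.1 i).valMinAbs).natAbs))
          ≤ ∑ b : Edge 3 L, c * (ℓF a * ((54 : ℝ)⁻¹) ^ (Finset.univ.sup fun i : Fin 3 => ((a.1 i - e.1 i).valMinAbs).natAbs)) * (ℓG b * ((54 : ℝ)⁻¹) ^ (Finset.univ.sup fun i : Fin 3 => ((e'.1 i - e.1 i).valMinAbs).natAbs)) :=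
            Finset.sum_le_sum fun b _ => hterm e e' a b
        _ = ∑ b : Edge 3 L, (c * (ℓF a * ((54 : ℝ)⁻¹) ^ (Finset.univ.sup fun i : Fin 3 => ((a.1 i - e.1 i).valMinAbs).natAbs)) * ((54 : ℝ)⁻¹) ^ (Finset.univ.sup fun i : Fin 3 => ((e'.1 i - e.1 i).valMinAbs).natAbs)) * ℓG b :=
            Finset.sum_congr rfl fun b _ => by ring
        _ = (c * (ℓF a * ((54 : ℝ)⁻¹) ^ (Finset.univ.sup fun i : Fin 3 => ((a.1 i - e.1 i).valMinAbs).natAbs)) * ((54 : ℝ)⁻¹) ^ (Finset.univ.sup fun i : Fin 3 => ((e'.1 i - e.1 i).valMinAbs).natAbs)) * SG := by rw [← Finset.mul_sum, hSG]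
        _ = _ := by ring
    -- sum over `e'`
    have he' : ∀ a : Edge 3 L, ∑ e' : Edge 3 L, ∑ b : Edge 3 L, ℓF a * ((108 : ℝ)⁻¹) ^ (Finset.univ.sup fun i : Fin 3 => ((a.1 i - e.1 i).valMinAbs).natAbs) * (ℓG b * ((108 : ℝ)⁻¹) ^ (Finset.univ.sup fun i : Fin 3 => ((b.1 i - e'.1 i).valMinAbs).natAbs) * ((108 : ℝ)⁻¹) ^ (Finset.univ.sup fun i : Fin 3 => ((e'.1 i - e.1 i).valMinAbs).natAbs)) ≤
        6 * c * SG * (ℓF a * ((54 : ℝ)⁻¹) ^ (Finset.univ.sup fun i : Fin 3 => ((a.1 i - e.1 i).valMinAbs).natAbs)) := by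
      intro a
      have hK : 0 ≤ c * SG * (ℓF a * ((54 : ℝ)⁻¹) ^ (Finset.univ.sup fun i : Fin 3 => ((a.1 i - e.1 i).valMinAbs).natAbs)) := by have := hℓF a; positivity
      calc ∑ e' : Edge 3 L, ∑ b : Edge 3 L, ℓF a * ((108 : ℝ)⁻¹) ^ (Finset.univ.sup fun i : Fin 3 => ((a.1 i - e.1 i).valMinAbs).natAbs) * (ℓG b * ((108 : ℝ)⁻¹) ^ (Finset.univ.sup fun i : Fin 3 => ((b.1 i - e'.1 i).valMinAbs).natAbs) * ((108 : ℝ)⁻¹) ^ (Finset.univ.sup fun i : Fin 3 => ((e'.1 i - e.1 i).valMinAbs).natAbs))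
          ≤ ∑ e' : Edge 3 L, c * SG * (ℓF a * ((54 : ℝ)⁻¹) ^ (Finset.univ.sup fun i : Fin 3 => ((a.1 i - e.1 i).valMinAbs).natAbs)) * ((54 : ℝ)⁻¹) ^ (Finset.univ.sup fun i : Fin 3 => ((e'.1 i - e.1 i).valMinAbs).natAbs) := Finset.sum_le_sum fun e' _ => hb a e'
        _ = c * SG * (ℓF a * ((54 : ℝ)⁻¹) ^ (Finset.univ.sup fun i : Fin 3 => ((a.1 i - e.1 i).valMinAbs).natAbs)) * ∑ e' : Edge 3 L, ((54 : ℝ)⁻¹) ^ (Finset.univ.sup fun i : Fin 3 => ((e'.1 i - e.1 i).valMinAbs).natAbs) := by rw [Finset.mul_sum]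
        _ ≤ c * SG * (ℓF a * ((54 : ℝ)⁻¹) ^ (Finset.univ.sup fun i : Fin 3 => ((a.1 i - e.1 i).valMinAbs).natAbs)) * 6 := mul_le_mul_of_nonneg_left (h54e e) hK
        _ = _ := by ring
    -- expand the product and sum over `a`
    have hexp : (∑ a : Edge 3 L, ℓF a * ((108 : ℝ)⁻¹) ^ (Finset.univ.sup fun i : Fin 3 => ((a.1 i - e.1 i).valMinAbs).natAbs)) *
        (∑ e' : Edge 3 L, (∑ b : Edge 3 L, ℓG b * ((108 : ℝ)⁻¹) ^ (Finset.univ.sup fun i : Fin 3 => ((b.1 i - e'.1 i).valMinAbs).natAbs)) * ((108 : ℝ)⁻¹) ^ (Finset.univ.sup fun i : Fin 3 => ((e'.1 i - e.1 i).valMinAbs).natAbs)) =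
        ∑ a : Edge 3 L, ∑ e' : Edge 3 L, ∑ b : Edge 3 L, ℓF a * ((108 : ℝ)⁻¹) ^ (Finset.univ.sup fun i : Fin 3 => ((a.1 i - e.1 i).valMinAbs).natAbs) * (ℓG b * ((108 : ℝ)⁻¹) ^ (Finset.univ.sup fun i : Fin 3 => ((b.1 i - e'.1 i).valMinAbs).natAbs) * ((108 : ℝ)⁻¹) ^ (Finset.univ.sup fun i : Fin 3 => ((e'.1 i - e.1 i).valMinAbs).natAbs)) := by
      rw [Finset.sum_mul_sum]
      refine Finset.sum_congr rfl fun a _ => Finset.sum_congr rfl fun e' _ => ?_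
      rw [Finset.sum_mul, Finset.mul_sum]
    rw [hexp]
    calc ∑ a : Edge 3 L, ∑ e' : Edge 3 L, ∑ b : Edge 3 L, ℓF a * ((108 : ℝ)⁻¹) ^ (Finset.univ.sup fun i : Fin 3 => ((a.1 i - e.1 i).valMinAbs).natAbs) * (ℓG b * ((108 : ℝ)⁻¹) ^ (Finset.univ.sup fun i : Fin 3 => ((b.1 i - e'.1 i).valMinAbs).natAbs) * ((108 : ℝ)⁻¹) ^ (Finset.univ.sup fun i : Fin 3 => ((e'.1 i - e.1 i).valMinAbs).natAbs))
        ≤ ∑ a : Edge 3 L, 6 * c * SG * (ℓF a * ((54 : ℝ)⁻¹) ^ (Finset.univ.sup fun i : Fin 3 => ((a.1 i - e.1 i).valMinAbs).natAbs)) := Finset.sum_le_sum fun a _ => he' a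
      _ = _ := by rw [Finset.mul_sum]
  have houter : ∑ e : Edge 3 L, ∑ a : Edge 3 L, ℓF a * ((54 : ℝ)⁻¹) ^ (Finset.univ.sup fun i : Fin 3 => ((a.1 i - e.1 i).valMinAbs).natAbs) ≤ 6 * ∑ a : Edge 3 L, ℓF a := by
    rw [Finset.sum_comm, Finset.mul_sum]
    refine Finset.sum_le_sum fun a _ => ?_
    rw [← Finset.mul_sum, mul_comm (6 : ℝ)]
    exact mul_le_mul_of_nonneg_left (h54a a) (hℓF a)
  have hK0 : 0 ≤ 6 * c * SG := by positivity
  calc _ ≤ ∑ e : Edge 3 L, 6 * c * SG * ∑ a : Edge 3 L, ℓF a * ((54 : ℝ)⁻¹) ^ (Finset.univ.sup fun i : Fin 3 => ((a.1 i - e.1 i).valMinAbs).natAbs) := Finset.sum_le_sum fun e _ => hMe e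
    _ = 6 * c * SG * ∑ e : Edge 3 L, ∑ a : Edge 3 L, ℓF a * ((54 : ℝ)⁻¹) ^ (Finset.univ.sup fun i : Fin 3 => ((a.1 i - e.1 i).valMinAbs).natAbs) := by rw [Finset.mul_sum]
    _ ≤ 6 * c * SG * (6 * ∑ a : Edge 3 L, ℓF a) := mul_le_mul_of_nonneg_left houter hK0
    _ = _ := by rw [hc, hSG]; ring

/-! ## §2. The space-time light cone -/

/-- ★★★ **Space-time light cone from EVERY deterministic start (every coupling `β'`, every volume).**  For `C³` functions `f, g` of the real link
coordinates with link-Lipschitz profiles `ℓ^F, ℓ^G ≥ 0` supported on link sets `Λ_F, Λ_G` at cyclic sup-distance `≥ R+1`, every realising Markov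
kernel family `κ`, all lattice times `s, t` and EVERY start `x`:
`|κ_s(F·κ_tG)(x) − κ_sF(x)·κ_(t+s)G(x)| ≤ 576·s·e^(λ(2s+t))·2^(−(R+1))·Σℓ^F·Σℓ^G`, `λ = |β'|(4+4√2+12·108)` — the two-time correlation function
`E_x[F(U_s)G(U_(s+t))] − E_x[F(U_s)]·E_x[G(U_(s+t))]` of the Markov process started at `x`, read through its semigroup.  The equal-time covariance
bound of file 35 applied to `F` and the evolved observable `κ_tG` (a `C³_c` function of the coordinates, `transitionKernel_preserves_dynkinClass`,
with the Lieb–Robinson profile `e^(λt)Σ_b ℓ^G_b 108^(−D(b,·))`), Chapman–Kolmogorov, and `overlapSum_convolution_le_of_separated`. [folklore] -/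
theorem transition_twoTime_covariance_abs_le_lightCone_of_separated (L : ℕ) [NeZero L] (β' : ℝ)
    (κ : ℝ≥0 → Kernel (GaugeConfig 3 L (Matrix.specialUnitaryGroup (Fin 2) ℂ))
      (GaugeConfig 3 L (Matrix.specialUnitaryGroup (Fin 2) ℂ))) [∀ t, IsMarkovKernel (κ t)]
    (hreal : ∀ (t : ℝ≥0) (x : GaugeConfig 3 L (Matrix.specialUnitaryGroup (Fin 2) ℂ))
        (Ω : Type) [MeasurableSpace Ω] (P : Measure Ω) [IsProbabilityMeasure P]
        (W : ℝ≥0 → Ω → (Edge 3 L × NoiseIdx 2 → ℝ)) (hW : IsFlatBrownian W P)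
        (U : ℝ≥0 → Ω → GaugeConfig 3 L (Matrix.specialUnitaryGroup (Fin 2) ℂ)),
        (∀ ω, U 0 ω = x) →
        (latticeLangevinDynamics (fundamentalLatticeRep 2) β').IsSolution (fundamentalRep (Fin 2))
          hW.natFiltration P W U →
        κ t x = P.map (U t))
    {f : (Edge 3 L × Fin 2 × Fin 2 × Bool → ℝ) → ℝ} (hf : ContDiff ℝ 3 f) {ℓF : Edge 3 L → ℝ} (hℓF : ∀ e, 0 ≤ ℓF e)
    {g : (Edge 3 L × Fin 2 × Fin 2 × Bool → ℝ) → ℝ} (hg : ContDiff ℝ 3 g) {ℓG : Edge 3 L → ℝ} (hℓG : ∀ e, 0 ≤ ℓG e)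
    (Λf Λg : Finset (Edge 3 L)) (hΛf : ∀ e, e ∉ Λf → ℓF e = 0) (hΛg : ∀ e, e ∉ Λg → ℓG e = 0) (R : ℕ)
    (hsep : ∀ e' ∈ Λf, ∀ e ∈ Λg, R + 1 ≤ (Finset.univ.sup fun i : Fin 3 => ((e'.1 i - e.1 i).valMinAbs).natAbs))
    (s t : ℝ≥0) (x : (GaugeConfig 3 L (Matrix.specialUnitaryGroup (Fin 2) ℂ))) :
    let coords : GaugeConfig 3 L (Matrix.specialUnitaryGroup (Fin 2) ℂ) → (Edge 3 L × Fin 2 × Fin 2 × Bool → ℝ) :=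
      fun V q => (fun z : ℂ => if q.2.2.2 then z.im else z.re)
        ((fundamentalRep (Fin 2) (V q.1) : Matrix (Fin 2) (Fin 2) ℂ) q.2.1 q.2.2.1)
    (∀ (e : Edge 3 L) (y y' : (GaugeConfig 3 L (Matrix.specialUnitaryGroup (Fin 2) ℂ))), (∀ f', f' ≠ e → y f' = y' f') →
      |f (coords y) - f (coords y')| ≤ ℓF e * frobNorm ((y e : Matrix (Fin 2) (Fin 2) ℂ) - (y' e : Matrix (Fin 2) (Fin 2) ℂ))) →
    (∀ (e : Edge 3 L) (y y' : (GaugeConfig 3 L (Matrix.specialUnitaryGroup (Fin 2) ℂ))), (∀ f', f' ≠ e → y f' = y' f') →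
      |g (coords y) - g (coords y')| ≤ ℓG e * frobNorm ((y e : Matrix (Fin 2) (Fin 2) ℂ) - (y' e : Matrix (Fin 2) (Fin 2) ℂ))) →
    |(∫ y, f (coords y) * (∫ z, g (coords z) ∂(κ t y)) ∂(κ s x)) - (∫ y, f (coords y) ∂(κ s x)) * (∫ z, g (coords z) ∂(κ (t + s) x))| ≤
      576 * (s : ℝ) * Real.exp ((|β'| * (4 + 4 * Real.sqrt 2 + 12 * 108)) * (2 * (s : ℝ) + (t : ℝ))) * ((2 : ℝ)⁻¹) ^ (R + 1) * (∑ e : Edge 3 L, ℓF e) * (∑ e : Edge 3 L, ℓG e) := by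
  intro coords hLf hLg
  classical
  haveI := secondCountableTopology_su2
  haveI := borelSpace_config L
  have hco : Continuous coords := continuous_coords (L := L)
  have cG : Continuous fun y : (GaugeConfig 3 L (Matrix.specialUnitaryGroup (Fin 2) ℂ)) => g (coords y) := hg.continuous.comp hco
  -- the evolved observable `κ_t G` as a `C³` function of the coordinates, with its Lieb–Robinson profile
  obtain ⟨g', hg', -, hg'rep⟩ := transitionKernel_preserves_dynkinClass L β' κ hreal t hg
  have hGrep : ∀ y : (GaugeConfig 3 L (Matrix.specialUnitaryGroup (Fin 2) ℂ)), ∫ z, g (coords z) ∂(κ t y) = g' (coords y) := fun y => hg'rep y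
  set ℓG' : Edge 3 L → ℝ := fun e => Real.exp ((|β'| * (4 + 4 * Real.sqrt 2 + 12 * 108)) * (t : ℝ)) * ∑ b : Edge 3 L, ℓG b * ((108 : ℝ)⁻¹) ^ (Finset.univ.sup fun i : Fin 3 => ((b.1 i - e.1 i).valMinAbs).natAbs) with hℓG'
  have hℓG'0 : ∀ e, 0 ≤ ℓG' e := fun e => mul_nonneg (Real.exp_nonneg _) (Finset.sum_nonneg fun b _ => mul_nonneg (hℓG b) (by positivity))
  have hLg' : ∀ (e : Edge 3 L) (y y' : (GaugeConfig 3 L (Matrix.specialUnitaryGroup (Fin 2) ℂ))), (∀ f', f' ≠ e → y f' = y' f') →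
      |g' (coords y) - g' (coords y')| ≤ ℓG' e * frobNorm ((y e : Matrix (Fin 2) (Fin 2) ℂ) - (y' e : Matrix (Fin 2) (Fin 2) ℂ)) := by
    intro e y y' hyy'
    rw [← hGrep y, ← hGrep y']
    exact transitionKernel_linkLipschitz_profile L β' κ hreal cG hℓG hLg t e y y' hyy'
  -- equal-time light cone at time `s` for `F` and `κ_t G`
  have h35 := transition_covariance_abs_le_lightCone L β' κ hreal hf hℓF hg' hℓG'0 s x hLf hLg'
  -- Chapman–Kolmogorov and the identification of the integrands
  have eCK : ∫ y, g' (coords y) ∂(κ s x) = ∫ z, g (coords z) ∂(κ (t + s) x) := by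
    rw [← transition_transition_cylinder_eq L β' κ hreal cG t s x]
    exact integral_congr_ae (ae_of_all _ fun y => (hGrep y).symm)
  have eFG : ∫ y, f (coords y) * g' (coords y) ∂(κ s x) = ∫ y, f (coords y) * (∫ z, g (coords z) ∂(κ t y)) ∂(κ s x) :=
    integral_congr_ae (ae_of_all _ fun y => by simp only [hGrep y])
  rw [← eCK, ← eFG]
  refine h35.trans ?_
  -- the geometry
  have hgeo := overlapSum_convolution_le_of_separated (L := L) hℓF hℓG Λf Λg hΛf hΛg R hsep
  have hS : (∑ e : Edge 3 L, (∑ e' : Edge 3 L, ℓF e' * ((108 : ℝ)⁻¹) ^ (Finset.univ.sup fun i : Fin 3 => ((e'.1 i - e.1 i).valMinAbs).natAbs)) * (∑ e' : Edge 3 L, ℓG' e' * ((108 : ℝ)⁻¹) ^ (Finset.univ.sup fun i : Fin 3 => ((e'.1 i - e.1 i).valMinAbs).natAbs))) ≤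
      Real.exp ((|β'| * (4 + 4 * Real.sqrt 2 + 12 * 108)) * (t : ℝ)) * (36 * ((2 : ℝ)⁻¹) ^ (R + 1) * ((∑ e : Edge 3 L, ℓF e) * ∑ e : Edge 3 L, ℓG e)) := by
    have e1 : ∀ e : Edge 3 L, (∑ e' : Edge 3 L, ℓG' e' * ((108 : ℝ)⁻¹) ^ (Finset.univ.sup fun i : Fin 3 => ((e'.1 i - e.1 i).valMinAbs).natAbs)) =
        Real.exp ((|β'| * (4 + 4 * Real.sqrt 2 + 12 * 108)) * (t : ℝ)) * (∑ e' : Edge 3 L, (∑ b : Edge 3 L, ℓG b * ((108 : ℝ)⁻¹) ^ (Finset.univ.sup fun i : Fin 3 => ((b.1 i - e'.1 i).valMinAbs).natAbs)) * ((108 : ℝ)⁻¹) ^ (Finset.univ.sup fun i : Fin 3 => ((e'.1 i - e.1 i).valMinAbs).natAbs)) := by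
      intro e; rw [hℓG', Finset.mul_sum]; exact Finset.sum_congr rfl fun e' _ => by ring
    simp_rw [e1]
    have e2 : (∑ e : Edge 3 L, (∑ e' : Edge 3 L, ℓF e' * ((108 : ℝ)⁻¹) ^ (Finset.univ.sup fun i : Fin 3 => ((e'.1 i - e.1 i).valMinAbs).natAbs)) *
        (Real.exp ((|β'| * (4 + 4 * Real.sqrt 2 + 12 * 108)) * (t : ℝ)) * (∑ e' : Edge 3 L, (∑ b : Edge 3 L, ℓG b * ((108 : ℝ)⁻¹) ^ (Finset.univ.sup fun i : Fin 3 => ((b.1 i - e'.1 i).valMinAbs).natAbs)) * ((108 : ℝ)⁻¹) ^ (Finset.univ.sup fun i : Fin 3 => ((e'.1 i - e.1 i).valMinAbs).natAbs)))) =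
        Real.exp ((|β'| * (4 + 4 * Real.sqrt 2 + 12 * 108)) * (t : ℝ)) * (∑ e : Edge 3 L, (∑ a : Edge 3 L, ℓF a * ((108 : ℝ)⁻¹) ^ (Finset.univ.sup fun i : Fin 3 => ((a.1 i - e.1 i).valMinAbs).natAbs)) *
          (∑ e' : Edge 3 L, (∑ b : Edge 3 L, ℓG b * ((108 : ℝ)⁻¹) ^ (Finset.univ.sup fun i : Fin 3 => ((b.1 i - e'.1 i).valMinAbs).natAbs)) * ((108 : ℝ)⁻¹) ^ (Finset.univ.sup fun i : Fin 3 => ((e'.1 i - e.1 i).valMinAbs).natAbs))) := by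
      rw [Finset.mul_sum]; exact Finset.sum_congr rfl fun e _ => by ring
    rw [e2]
    exact mul_le_mul_of_nonneg_left hgeo (Real.exp_nonneg _)
  have h0 : 0 ≤ 16 * (s : ℝ) * Real.exp (2 * ((|β'| * (4 + 4 * Real.sqrt 2 + 12 * 108)) * (s : ℝ))) := by positivity
  have hexp : Real.exp (2 * ((|β'| * (4 + 4 * Real.sqrt 2 + 12 * 108)) * (s : ℝ))) * Real.exp ((|β'| * (4 + 4 * Real.sqrt 2 + 12 * 108)) * (t : ℝ)) = Real.exp ((|β'| * (4 + 4 * Real.sqrt 2 + 12 * 108)) * (2 * (s : ℝ) + (t : ℝ))) := by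
    rw [← Real.exp_add]; congr 1; ring
  calc 16 * (s : ℝ) * Real.exp (2 * ((|β'| * (4 + 4 * Real.sqrt 2 + 12 * 108)) * (s : ℝ))) * (∑ e : Edge 3 L, (∑ e' : Edge 3 L, ℓF e' * ((108 : ℝ)⁻¹) ^ (Finset.univ.sup fun i : Fin 3 => ((e'.1 i - e.1 i).valMinAbs).natAbs)) * (∑ e' : Edge 3 L, ℓG' e' * ((108 : ℝ)⁻¹) ^ (Finset.univ.sup fun i : Fin 3 => ((e'.1 i - e.1 i).valMinAbs).natAbs)))
      ≤ 16 * (s : ℝ) * Real.exp (2 * ((|β'| * (4 + 4 * Real.sqrt 2 + 12 * 108)) * (s : ℝ))) * (Real.exp ((|β'| * (4 + 4 * Real.sqrt 2 + 12 * 108)) * (t : ℝ)) * (36 * ((2 : ℝ)⁻¹) ^ (R + 1) * ((∑ e : Edge 3 L, ℓF e) * ∑ e : Edge 3 L, ℓG e))) :=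
        mul_le_mul_of_nonneg_left hS h0
    _ = 576 * (s : ℝ) * (Real.exp (2 * ((|β'| * (4 + 4 * Real.sqrt 2 + 12 * 108)) * (s : ℝ))) * Real.exp ((|β'| * (4 + 4 * Real.sqrt 2 + 12 * 108)) * (t : ℝ))) * ((2 : ℝ)⁻¹) ^ (R + 1) * (∑ e : Edge 3 L, ℓF e) * (∑ e : Edge 3 L, ℓG e) := by ring
    _ = _ := by rw [hexp]

end Summit.QuantumFields.YangMills.Theorems.ColdStartUniversality.LiebRobinson

end
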